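import Summits.CriticalPhenomena.PercolationContinuityZ3.Theorems.SahiAEVersionTransportPrelim

/-!
# The randomized probability integral transform (preliminaries for reference measures with atoms)

Support file of the Sahi cell (`prim-sahi`, typer seat, generation 21; `--supports stmt-CriticalPhenomena-4575`).
Tools for `SahiAEVersionTransportAtoms.lean` (Borel everywhere-MTP₂ versions under products of ARBITRARY σ-finite
measures on `ℝ`).  For a probability measure `μ` on `ℝ` with distribution function `Φ = cdf μ`, left limits
`Φ(t−) = leftLim Φ t` and quantile `Q = RealQuantile.rq μ`:

* `rpit μ t v = Φ(t−) + v (Φ(t) − Φ(t−))` — the randomized probability integral transform, in print Rüschendorf's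
  (generalized) DISTRIBUTIONAL TRANSFORM [Ruschendorf2013, Def. 1.2, eq. (1.8)] ("at any jump point of the distribution
  function one uses `V` to randomize the jump height"; Prop. 1.3 there: `U = F(Y−) + V(F(Y) − F(Y−))` is uniform and
  `F⁻¹(U) = Y` a.s.): for `v ∈ [0,1]` it sweeps the jump interval `[Φ(t−), Φ(t)]` of `t` (a point when `t` is not an
  atom); monotone in `v`, and `rpit μ s · ≤ rpit μ t ·` for `s < t` (`rpit_le_rpit_of_lt`);
* `leftLim_cdf_rq_le` / `le_cdf_rq`: `Φ(Q(u)−) ≤ u ≤ Φ(Q(u))` for `u ∈ (0,1)`;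
* `rq_rpit_rq`: `Q (rpit μ (Q u) v) = Q u` for `u, v ∈ (0,1)` (resampling inside the jump interval does not change
  the quantile), `rpit_rq_mem_Ioo`;
* `quasiMeasurePreserving_rpit_rqe` — `(u, v) ↦ rpit μ (Q u) v` maps `λ|_{(0,1)} ⊗ λ|_{(0,1)}`-null sets to
  `λ|_{(0,1)}`-null sets (an affine image on atoms, the identity off atoms).

No sorries, no new axioms.
-/

noncomputable section

namespace Summit.CriticalPhenomena.PercolationContinuityZ3.Theorems.SahiAEFourFunctions

open MeasureTheory Set Filter Topology ProbabilityTheory RealQuantile Function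
open scoped ENNReal NNReal

variable (μ : Measure ℝ)

/-! ### Left limits of the distribution function -/

/-- `Φ(t−) ≤ Φ(t)`. [folklore] -/
theorem leftLim_cdf_le_cdf (t : ℝ) : leftLim (cdf μ) t ≤ cdf μ t := (monotone_cdf μ).leftLim_le le_rfl

/-- `Φ(s) ≤ Φ(t−)` for `s < t`. [folklore] -/
theorem cdf_le_leftLim_cdf {s t : ℝ} (h : s < t) : cdf μ s ≤ leftLim (cdf μ) t := (monotone_cdf μ).le_leftLim h

/-- `0 ≤ Φ(t−)`. [folklore] -/
theorem leftLim_cdf_nonneg (t : ℝ) : 0 ≤ leftLim (cdf μ) t :=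
  ge_of_tendsto ((monotone_cdf μ).tendsto_leftLim t) (Eventually.of_forall fun s => cdf_nonneg μ s)

/-- `t ↦ Φ(t−)` is measurable (it is monotone). [folklore] -/
theorem measurable_leftLim_cdf : Measurable (leftLim (cdf μ)) := (monotone_cdf μ).leftLim.measurable

/-- `Φ(Q(u)−) ≤ u` for `u ∈ (0,1)`: below the quantile the distribution function stays below the level. [folklore] -/
theorem leftLim_cdf_rq_le {u : ℝ} (hu : u ∈ Ioo (0 : ℝ) 1) : leftLim (cdf μ) (rq μ u) ≤ u := by
  refine le_of_tendsto ((monotone_cdf μ).tendsto_leftLim (rq μ u)) ?_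
  refine eventually_nhdsWithin_of_forall fun s hs => ?_
  by_contra hlt
  have : rq μ u ≤ s := (rq_le_iff μ hu.1 hu.2 s).2 (not_le.1 hlt).le
  exact (lt_irrefl _) (this.trans_lt hs)

/-! ### The randomized probability integral transform -/

/-- **The randomized probability integral transform** `(t, v) ↦ Φ(t−) + v (Φ(t) − Φ(t−))` = Rüschendorf's
(generalized) distributional transform `F(x, λ) = P(Y < x) + λ P(Y = x)` evaluated at `x = t`, `λ = v`.
[cite: Ruschendorf2013, Def. 1.2, eq. (1.8)] -/
def rpit (t v : ℝ) : ℝ := leftLim (cdf μ) t + v * (cdf μ t - leftLim (cdf μ) t)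

/-- Unfolding lemma. [folklore] -/
theorem rpit_apply (t v : ℝ) : rpit μ t v = leftLim (cdf μ) t + v * (cdf μ t - leftLim (cdf μ) t) := rfl

/-- Joint measurability of `rpit`. [folklore] -/
theorem measurable_rpit : Measurable fun p : ℝ × ℝ => rpit μ p.1 p.2 :=
  ((measurable_leftLim_cdf μ).comp measurable_fst).add (measurable_snd.mul
    (((monotone_cdf μ).measurable.comp measurable_fst).sub ((measurable_leftLim_cdf μ).comp measurable_fst)))

/-- `rpit μ t` is monotone in the randomization variable. [folklore] -/
theorem rpit_mono_right (t : ℝ) : Monotone (rpit μ t) := fun v w hvw => by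
  simp only [rpit_apply]
  have h := sub_nonneg.2 (leftLim_cdf_le_cdf μ t)
  nlinarith

/-- For `v ∈ [0,1]`, `rpit μ t v` lies in the jump interval `[Φ(t−), Φ(t)]`. [folklore] -/
theorem rpit_mem_Icc (t : ℝ) {v : ℝ} (hv : v ∈ Icc (0 : ℝ) 1) : rpit μ t v ∈ Icc (leftLim (cdf μ) t) (cdf μ t) := by
  simp only [rpit_apply, mem_Icc]
  have h := sub_nonneg.2 (leftLim_cdf_le_cdf μ t)
  constructor <;> nlinarith [hv.1, hv.2]

/-- For `s < t` the jump intervals are ordered: `rpit μ s u ≤ rpit μ t v` (`u, v ∈ [0,1]`). [folklore] -/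
theorem rpit_le_rpit_of_lt {s t : ℝ} (h : s < t) {u v : ℝ} (hu : u ∈ Icc (0 : ℝ) 1) (hv : v ∈ Icc (0 : ℝ) 1) :
    rpit μ s u ≤ rpit μ t v :=
  ((rpit_mem_Icc μ s hu).2.trans (cdf_le_leftLim_cdf μ h)).trans (rpit_mem_Icc μ t hv).1

/-- `rpit μ t v ∈ [0,1]` for `v ∈ [0,1]`. [folklore] -/
theorem rpit_mem_Icc_zero_one (t : ℝ) {v : ℝ} (hv : v ∈ Icc (0 : ℝ) 1) : rpit μ t v ∈ Icc (0 : ℝ) 1 :=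
  ⟨(leftLim_cdf_nonneg μ t).trans (rpit_mem_Icc μ t hv).1, (rpit_mem_Icc μ t hv).2.trans (cdf_le_one μ t)⟩

/-! ### Resampling inside the jump interval does not change the quantile -/

/-- For `u, v ∈ (0,1)`: `rpit μ (Q u) v ∈ (0,1)` and `Q (rpit μ (Q u) v) = Q u` — the pointwise core of
`F⁻¹(U) = Y` a.s. for the distributional transform `U`. [cite: Ruschendorf2013, Prop. 1.3 (second half), pointwise form] -/
theorem rq_rpit_rq {u v : ℝ} (hu : u ∈ Ioo (0 : ℝ) 1) (hv : v ∈ Ioo (0 : ℝ) 1) :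
    rpit μ (rq μ u) v ∈ Ioo (0 : ℝ) 1 ∧ rq μ (rpit μ (rq μ u) v) = rq μ u := by
  set t := rq μ u with ht
  have hL : leftLim (cdf μ) t ≤ u := leftLim_cdf_rq_le μ hu
  have hU : u ≤ cdf μ t := le_cdf_rq μ hu.2
  rcases (sub_nonneg.2 (leftLim_cdf_le_cdf μ t)).eq_or_lt with h0 | hpos
  · -- no atom at `t`: the transform is the identity
    have hk : rpit μ t v = u := by
      rw [rpit_apply, ← h0, mul_zero, add_zero]
      exact le_antisymm hL (by linarith [sub_eq_zero.1 h0.symm])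
    rw [hk]
    exact ⟨hu, rfl⟩
  · -- atom at `t`: the transform lands strictly inside the jump interval
    have hk1 : leftLim (cdf μ) t < rpit μ t v := by
      rw [rpit_apply]; nlinarith [hv.1]
    have hk2 : rpit μ t v < cdf μ t := by
      rw [rpit_apply]; nlinarith [hv.2]
    have hk0 : 0 < rpit μ t v := (leftLim_cdf_nonneg μ t).trans_lt hk1
    have hk1' : rpit μ t v < 1 := hk2.trans_le (cdf_le_one μ t)
    refine ⟨⟨hk0, hk1'⟩, le_antisymm ((rq_le_iff μ hk0 hk1' t).2 hk2.le) ?_⟩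
    refine le_csInf (qSet_nonempty μ hk1') fun s hs => ?_
    by_contra hlt
    have h1 : cdf μ s ≤ leftLim (cdf μ) t := cdf_le_leftLim_cdf μ (not_le.1 hlt)
    exact (lt_irrefl _) ((((mem_qSet μ).1 hs).trans h1).trans_lt hk1)

/-! ### Null sets: the transform composed with the quantile is quasi-measure-preserving -/

/-- **`(u, v) ↦ rpit μ (Q u) v` maps `λ|_{(0,1)} ⊗ λ|_{(0,1)}`-null sets to `λ|_{(0,1)}`-null sets.**  Off atoms the
map is `(u, v) ↦ u`; on the `u`-interval of an atom `t` it is the affine map `v ↦ Φ(t−) + v μ{t}`.  (Weaker than, and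
implied by, the exact law `U ∼ U(0,1)` of [Ruschendorf2013, Prop. 1.3]; the null-set form is all the transport needs.)
[folklore] -/
theorem quasiMeasurePreserving_rpit_rqe [IsProbabilityMeasure μ] :
    Measure.QuasiMeasurePreserving (fun p : ℝ × ℝ => rpit μ (rqe μ p.1) p.2)
      (((volume : Measure ℝ).restrict (Ioo (0 : ℝ) 1)).prod ((volume : Measure ℝ).restrict (Ioo (0 : ℝ) 1)))
      ((volume : Measure ℝ).restrict (Ioo (0 : ℝ) 1)) := by
  set ν₁ : Measure ℝ := (volume : Measure ℝ).restrict (Ioo (0 : ℝ) 1) with hν₁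
  have hmeas : Measurable fun p : ℝ × ℝ => rpit μ (rqe μ p.1) p.2 :=
    (measurable_rpit μ).comp (((measurable_rqe μ).comp measurable_fst).prodMk measurable_snd)
  refine ⟨hmeas, Measure.AbsolutelyContinuous.mk fun s hs h0 => ?_⟩
  rw [Measure.map_apply hmeas hs, Measure.prod_apply (hmeas hs)]
  -- the exceptional set as a Lebesgue-null subset of `(0,1)`
  set N : Set ℝ := s ∩ Ioo (0 : ℝ) 1 with hN
  have hN0 : volume N = 0 := by rwa [hN, ← Measure.restrict_apply hs]
  have hν₁N : ν₁ N = 0 := le_antisymm ((Measure.restrict_apply_le _ _).trans hN0.le) zero_le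
  have hν₁c : ν₁ (Ioo (0 : ℝ) 1)ᶜ = 0 := by
    rw [hν₁, Measure.restrict_apply measurableSet_Ioo.compl, Set.compl_inter_self, measure_empty]
  have hae : ∀ᵐ u ∂ν₁, u ∈ Ioo (0 : ℝ) 1 ∧ u ∉ N := by
    have h1 : ∀ᵐ u ∂ν₁, u ∈ Ioo (0 : ℝ) 1 := ae_restrict_mem measurableSet_Ioo
    have h2 : ∀ᵐ u ∂ν₁, u ∉ N := by
      rw [ae_iff]; simpa only [not_not, setOf_mem_eq] using hν₁N
    filter_upwards [h1, h2] with u h1 h2 using ⟨h1, h2⟩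
  -- the fibre of the preimage over a.e. `u` is `ν₁`-null
  have hzero : ∀ᵐ u ∂ν₁, ν₁ (Prod.mk u ⁻¹' ((fun p : ℝ × ℝ => rpit μ (rqe μ p.1) p.2) ⁻¹' s)) = 0 := by
    filter_upwards [hae] with u hu
    have hpre : Prod.mk u ⁻¹' ((fun p : ℝ × ℝ => rpit μ (rqe μ p.1) p.2) ⁻¹' s) = {v | rpit μ (rq μ u) v ∈ s} := by
      ext v
      simp only [mem_preimage, mem_setOf_eq, rqe_of_mem μ hu.1]
    rw [hpre]
    set t := rq μ u with ht
    rcases (sub_nonneg.2 (leftLim_cdf_le_cdf μ t)).eq_or_lt with h0 | hpos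
    · -- no atom at `t`: `rpit μ t v = u ∉ s` for every `v`
      have hk : ∀ v, rpit μ t v = u := fun v => by
        rw [rpit_apply, ← h0, mul_zero, add_zero]
        have h1 : leftLim (cdf μ) t = cdf μ t := by linarith [sub_eq_zero.1 h0.symm]
        exact le_antisymm (leftLim_cdf_rq_le μ hu.1) (h1 ▸ le_cdf_rq μ hu.1.2)
      have hempty : {v | rpit μ t v ∈ s} = ∅ := by
        ext v
        simp only [mem_setOf_eq, hk v, mem_empty_iff_false, iff_false]
        exact fun hs' => hu.2 ⟨hs', hu.1⟩
      rw [hempty, measure_empty]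
    · -- atom at `t`: an affine image of the null set `N`, up to the null set `(0,1)ᶜ`
      have hm : cdf μ t - leftLim (cdf μ) t ≠ 0 := hpos.ne'
      have hsub : {v | rpit μ t v ∈ s} ⊆
          (fun v : ℝ => v * (cdf μ t - leftLim (cdf μ) t)) ⁻¹' ((fun w : ℝ => leftLim (cdf μ) t + w) ⁻¹' N) ∪
            (Ioo (0 : ℝ) 1)ᶜ := by
        intro v hv
        by_cases hv01 : v ∈ Ioo (0 : ℝ) 1
        · left
          have hk1 : leftLim (cdf μ) t < rpit μ t v := by rw [rpit_apply]; nlinarith [hv01.1]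
          have hk2 : rpit μ t v < cdf μ t := by rw [rpit_apply]; nlinarith [hv01.2]
          exact ⟨hv, (leftLim_cdf_nonneg μ t).trans_lt hk1, hk2.trans_le (cdf_le_one μ t)⟩
        · exact Or.inr hv01
      refine measure_mono_null hsub (measure_union_null ?_ hν₁c)
      refine le_antisymm ((Measure.restrict_apply_le _ _).trans ?_) zero_le
      rw [Real.volume_preimage_mul_right hm, measure_preimage_add, hN0, mul_zero]
  rw [lintegral_congr_ae (hzero : (fun u => ν₁ (Prod.mk u ⁻¹' ((fun p : ℝ × ℝ => rpit μ (rqe μ p.1) p.2) ⁻¹' s)))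
    =ᵐ[ν₁] fun _ => 0), lintegral_zero]

end Summit.CriticalPhenomena.PercolationContinuityZ3.Theorems.SahiAEFourFunctions
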